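import Summits.AtomisticToContinuum.BoseEinsteinCondensation.Theses.BECInsertionCorrector
import Summits.AtomisticToContinuum.BoseEinsteinCondensation.Theorems.StaticResponseBound.Negative.Basic
import Summits.AtomisticToContinuum.BoseEinsteinCondensation.Theorems.StaticResponseBound.Negative.CellToolkit
import Summits.AtomisticToContinuum.BoseEinsteinCondensation.Theorems.BECInsertionCorrectorStaticResponseBoundModulationToolkit
import Literature.MathematicalPhysics.QuantumManyBody.WeightedCorrector
import Literature.MathematicalPhysics.QuantumManyBody.PeriodicBoseGasMomentumSector
import Literature.MathematicalPhysics.QuantumManyBody.PeriodicHeatFlowSpectralProofs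
import HarnessLib

/-!
# From the all-states discriminant to hyperuniformity — stub B2

Helper file for the crux `BECInsertionCorrector.StaticResponseBound` (item
stmt-AtomisticToContinuum-12057), line `stable-fraction-square-completion`: the registered stub
**B2** `stub_responseToHyperuniformity` (brick B2 of the planner's brick library
`fsum-sector-sandwich`, statement verbatim from the lead skeleton v5): the converse moment bound
`m₀² ≤ m₁ m₋₁` in variational dress.  If, for a periodic `N`-body state `Θ` of total momentum `0`
(Born weight `|Θ|²` invariant under the simultaneous translation of all particles) and the density
wave `V_p = ∑ⱼ cos(p·xⱼ)`, `p = 2πk/L`, `k ≠ 0`, the all-states discriminant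
`(∫ V_p F² |Θ|²)² ≤ K (∫ F² |Θ|²) 𝓔_{|Θ|}(F, F)` holds for every Bose-symmetric periodic `C¹` test
`F`, then `(∫ V_p² |Θ|²)² ≤ K · N|p|²/8`.

Proof.  Test `F_ε = 1 + εV_p` (periodic, `C¹`, symmetric).  Translation invariance of the weight
kills the odd harmonics: shifting all particles by `s` with `p·s = π` (resp. `π/2`) leaves the cell
integral of a periodic integrand unchanged (`setIntegral_cellN_comp_add`) but flips the sign of
`V_p` (resp. of `∑ⱼ cos(2p·xⱼ)`), so `∫ V_p|Θ|² = 0` and `∫ ∑ⱼcos(2p·xⱼ)|Θ|² = 0`; with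
`|∇V_p|² = |p|² ∑ⱼ sin²(p·xⱼ) = |p|²(N − ∑ⱼcos(2p·xⱼ))/2` and `∫|Θ|² = 1` this gives
`𝓔_{|Θ|}(V_p, V_p) = N|p|²/2`.  Hence `∫V_pF_ε²|Θ|² = 2εA + ε²B`, `∫F_ε²|Θ|² = 1 + ε²A`,
`𝓔(F_ε, F_ε) = ε²N|p|²/2` (`A = ∫V_p²|Θ|²`, `B = ∫V_p³|Θ|²`), the hypothesis reads
`ε²(2A + εB)² ≤ ε² K(1 + ε²A) N|p|²/2`, and dividing by `ε² ≠ 0` and letting `ε → 0` along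
`𝓝[≠] 0` gives `4A² ≤ K N|p|²/2`.  All integrands are continuous on the bounded cell.  Tree
ingredients: `arg`/`argCLM` (Negative/CellToolkit), the periodicity of the density wave
`UvThomsonForceWave.sum_cos_add_single` (Theorems/…ModulationToolkit), the cell shift
`setIntegral_cellN_comp_add`, `dirichletFormW_sub_sub`, `gradDot_self_eq_sum_sq`,
`integral_norm_sq_eq_one`, `hasTotalMomentum_zero_iff`.

References: [Stringari1995] §3 (40) (the moment bounds `m₀² ≤ m₁m₋₁` for the static structure
factor); the `H₋₁` variational dress is that of `WeightedCorrector.lean` [KipnisLandim1999].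
No new definitions.
-/

namespace Summit.AtomisticToContinuum.BoseEinsteinCondensation.Cruxes.StaticResponseBound.StableFractionSquareCompletion

open MeasureTheory Filter
open scoped ENNReal Topology
open Literature.MathematicalPhysics.QuantumManyBody.BoseGas
open Summit.AtomisticToContinuum.BoseEinsteinCondensation.Theses
open Summit.AtomisticToContinuum.BoseEinsteinCondensation.Theorems.StaticResponseBound.Negative

noncomputable section

variable {N : ℕ} {L : ℝ}

/-! ### The phase `θ_k(x) = p·x` and the density wave `V_p = ∑ⱼ cos θ_k(xⱼ)` -/

/-- For `k ≠ 0` every phase is attained: `∃ s, θ_k(s) = θ`. [folklore] -/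
theorem b2_exists_arg_eq (hL : L ≠ 0) {k : Fin 3 → ℤ} (hk : k ≠ 0) (θ : ℝ) :
    ∃ s : Space, arg L k s = θ := by
  obtain ⟨a, ha⟩ : ∃ a, k a ≠ 0 := by
    by_contra h
    push Not at h
    exact hk (funext h)
  have ha' : (k a : ℝ) ≠ 0 := by exact_mod_cast ha
  refine ⟨EuclideanSpace.single a (θ * L / (2 * Real.pi * k a)), ?_⟩
  unfold arg
  simp only [PiLp.single_apply, mul_ite, mul_zero, Finset.sum_ite_eq', Finset.mem_univ, if_true]
  field_simp

/-- The density wave is Bose symmetric. [folklore] -/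
theorem b2_sumCos_perm (L : ℝ) (k : Fin 3 → ℤ) (σ : Equiv.Perm (Fin N)) (X : Config N) :
    (∑ j, Real.cos (arg L k ((X ∘ σ) j))) = ∑ j, Real.cos (arg L k (X j)) := by
  simp only [Function.comp_apply]
  exact Equiv.sum_comp σ (fun j => Real.cos (arg L k (X j)))

/-- The density wave is `C¹`. [folklore] -/
theorem b2_contDiff_sumCos (L : ℝ) (k : Fin 3 → ℤ) :
    ContDiff ℝ 1 fun X : Config N => ∑ j, Real.cos (arg L k (X j)) := by
  fun_prop

/-- The density wave is a periodic test function (for `L ≠ 0`). [folklore] -/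
theorem b2_isPeriodicTest_sumCos (hL : L ≠ 0) (k : Fin 3 → ℤ) :
    IsPeriodicTest L fun X : Config N => ∑ j, Real.cos (arg L k (X j)) :=
  ⟨b2_contDiff_sumCos L k, fun X i a => UvThomsonForceWave.sum_cos_add_single hL k X i a⟩

/-! ### Translation invariance kills the odd harmonics -/

/-- If a periodic integrand changes sign under a simultaneous translation of all particles, its
cell integral vanishes (the cell integral of a periodic function is shift invariant,
`setIntegral_cellN_comp_add`). [folklore] -/
theorem b2_integral_eq_zero_of_shift_neg (hL : 0 < L) {G : Config N → ℝ}
    (hG : ∀ (X : Config N) (i : Fin N) (a : Fin 3),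
      G (X + Pi.single i (EuclideanSpace.single a L)) = G X)
    (s : Space) (hs : ∀ X, G (X + fun _ => s) = -G X) :
    ∫ X in cellN N L, G X = 0 := by
  have h := setIntegral_cellN_comp_add hL hG (fun _ => s)
  simp_rw [hs, integral_neg] at h
  linarith

/-- **First harmonic.** `∫ (∑ⱼ cos θ_k(xⱼ)) w = 0` for `k ≠ 0` and a periodic weight `w` invariant
under simultaneous translations: shift by half a wavelength, `θ_k(s) = π`. [folklore] -/
theorem b2_integral_sumCos_mul_eq_zero (hL : 0 < L) {k : Fin 3 → ℤ} (hk : k ≠ 0)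
    {w : Config N → ℝ}
    (hwper : ∀ (X : Config N) (i : Fin N) (a : Fin 3),
      w (X + Pi.single i (EuclideanSpace.single a L)) = w X)
    (hwtr : ∀ (s : Space) (X : Config N), w (X + fun _ => s) = w X) :
    ∫ X in cellN N L, (∑ j, Real.cos (arg L k (X j))) * w X = 0 := by
  obtain ⟨s, hs⟩ := b2_exists_arg_eq hL.ne' hk Real.pi
  refine b2_integral_eq_zero_of_shift_neg hL (fun X i a => ?_) s (fun X => ?_)
  · rw [UvThomsonForceWave.sum_cos_add_single hL.ne', hwper]
  · rw [hwtr, ← neg_mul, ← Finset.sum_neg_distrib]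
    congr 1
    refine Finset.sum_congr rfl fun j _ => ?_
    simp only [Pi.add_apply]
    rw [← argCLM_apply, map_add, argCLM_apply, argCLM_apply, hs, Real.cos_add_pi]

/-! ### The gradient of the density wave and its Dirichlet form -/

/-- `d(cos θ_k(xⱼ)) = -sin θ_k(xⱼ) · θ_k ∘ projⱼ`. [folklore] -/
theorem b2_hasFDerivAt_cos_arg (L : ℝ) (k : Fin 3 → ℤ) (j : Fin N) (X : Config N) :
    HasFDerivAt (fun Y : Config N => Real.cos (arg L k (Y j)))
      ((-Real.sin (arg L k (X j))) •
        (argCLM L k).comp (ContinuousLinearMap.proj (R := ℝ) (φ := fun _ : Fin N => Space) j)) X := by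
  have hA : HasFDerivAt (fun Y : Config N => Y j)
      (ContinuousLinearMap.proj (R := ℝ) (φ := fun _ : Fin N => Space) j) X :=
    hasFDerivAt_apply (𝕜 := ℝ) j X
  have hB : HasFDerivAt (arg L k) (argCLM L k) (X j) := by
    have h := (argCLM L k).hasFDerivAt (x := X j)
    rwa [show ((argCLM L k : Space →L[ℝ] ℝ) : Space → ℝ) = arg L k from
      funext (argCLM_apply L k)] at h
  exact (Real.hasDerivAt_cos (arg L k (X j))).comp_hasFDerivAt X (hB.comp X hA)

/-- `∂_{i,a} ∑ⱼ cos θ_k(xⱼ) = -sin θ_k(xᵢ) · 2πk_a/L`. [folklore] -/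
theorem b2_fderiv_sumCos_apply (L : ℝ) (k : Fin 3 → ℤ) (X : Config N) (i : Fin N) (a : Fin 3) :
    fderiv ℝ (fun Y : Config N => ∑ j, Real.cos (arg L k (Y j))) X
        (Pi.single i (EuclideanSpace.single a 1)) =
      -Real.sin (arg L k (X i)) * (2 * Real.pi / L * k a) := by
  have h : HasFDerivAt (fun Y : Config N => ∑ j, Real.cos (arg L k (Y j)))
      (∑ j, (-Real.sin (arg L k (X j))) •
        (argCLM L k).comp (ContinuousLinearMap.proj (R := ℝ) (φ := fun _ : Fin N => Space) j)) X :=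
    HasFDerivAt.fun_sum fun j _ => b2_hasFDerivAt_cos_arg L k j X
  rw [h.fderiv]
  simp only [_root_.sum_apply, _root_.smul_apply, ContinuousLinearMap.comp_apply,
    ContinuousLinearMap.proj_apply, smul_eq_mul]
  rw [Finset.sum_eq_single i]
  · rw [Pi.single_eq_same, argCLM_single]
  · intro j _ hji
    rw [Pi.single_eq_of_ne hji, map_zero, mul_zero]
  · intro hi
    exact absurd (Finset.mem_univ i) hi

/-- `|∇ ∑ⱼ cos θ_k(xⱼ)|² = |p|² ∑ⱼ sin² θ_k(xⱼ)`. [folklore] -/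
theorem b2_gradDot_sumCos (L : ℝ) (k : Fin 3 → ℤ) (X : Config N) :
    gradDot (fun Y : Config N => ∑ j, Real.cos (arg L k (Y j)))
        (fun Y : Config N => ∑ j, Real.cos (arg L k (Y j))) X =
      psq L k * ∑ j, Real.sin (arg L k (X j)) ^ 2 := by
  rw [gradDot_self_eq_sum_sq, Finset.mul_sum]
  refine Finset.sum_congr rfl fun i _ => ?_
  simp_rw [b2_fderiv_sumCos_apply, mul_pow, neg_sq, ← Finset.mul_sum]
  unfold psq
  ring

/-- `∑ⱼ sin² θ_k(xⱼ) = N/2 - (∑ⱼ cos θ_{2k}(xⱼ))/2`. [folklore] -/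
theorem b2_sum_sin_sq (L : ℝ) (k : Fin 3 → ℤ) (X : Config N) :
    ∑ j, Real.sin (arg L k (X j)) ^ 2 =
      (N : ℝ) / 2 - (∑ j, Real.cos (arg L ((2 : ℤ) • k) (X j))) / 2 := by
  simp_rw [Real.sin_sq_eq_half_sub, arg_intSMul, Finset.sum_sub_distrib, Finset.sum_div]
  push_cast
  simp only [Finset.sum_const, Finset.card_univ, Fintype.card_fin, nsmul_eq_mul]
  ring

/-- **The Dirichlet form of the density wave**: `𝓔_{|Θ|}(V_p, V_p) = ∫ |p|² ∑ⱼ sin² θ_k(xⱼ) |Θ|² =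
N|p|²/2` for a normalised periodic state whose Born weight is invariant under simultaneous
translations (the second harmonic `∑ⱼ cos θ_{2k}(xⱼ)` integrates to zero). [folklore] -/
theorem b2_dirichletFormW_sumCos (hL : 0 < L) {k : Fin 3 → ℤ} (hk : k ≠ 0)
    (Θ : PeriodicTrialState N L)
    (hwtr : ∀ (s : Space) (X : Config N), ‖Θ.ψ (X + fun _ => s)‖ ^ 2 = ‖Θ.ψ X‖ ^ 2) :
    dirichletFormW L (fun X => ‖Θ.ψ X‖) (fun Y => ∑ j, Real.cos (arg L k (Y j)))
        (fun Y => ∑ j, Real.cos (arg L k (Y j))) = N * psq L k / 2 := by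
  have hψc := Θ.contDiff.continuous
  have hwper : ∀ (X : Config N) (i : Fin N) (a : Fin 3),
      ‖Θ.ψ (X + Pi.single i (EuclideanSpace.single a L))‖ ^ 2 = ‖Θ.ψ X‖ ^ 2 := fun X i a => by
    rw [Θ.periodic]
  have h2k : (2 : ℤ) • k ≠ 0 := smul_ne_zero two_ne_zero hk
  have hI2 := b2_integral_sumCos_mul_eq_zero (w := fun X => ‖Θ.ψ X‖ ^ 2) hL h2k hwper hwtr
  rw [dirichletFormW_def]
  simp_rw [b2_gradDot_sumCos, b2_sum_sin_sq]
  have hpt : (fun X : Config N => psq L k * ((N : ℝ) / 2 - (∑ j, Real.cos (arg L ((2 : ℤ) • k) (X j))) / 2) *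
      ‖Θ.ψ X‖ ^ 2) = fun X => psq L k / 2 * ((N : ℝ) * ‖Θ.ψ X‖ ^ 2) -
        psq L k / 2 * ((∑ j, Real.cos (arg L ((2 : ℤ) • k) (X j))) * ‖Θ.ψ X‖ ^ 2) := by
    funext X; ring
  have hi1 : Integrable (fun X : Config N => (N : ℝ) * ‖Θ.ψ X‖ ^ 2) (volume.restrict (cellN N L)) :=
    integrableOn_cellN (by fun_prop) L
  have hi2 : Integrable (fun X : Config N => (∑ j, Real.cos (arg L ((2 : ℤ) • k) (X j))) * ‖Θ.ψ X‖ ^ 2)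
      (volume.restrict (cellN N L)) :=
    integrableOn_cellN (by fun_prop) L
  rw [hpt, integral_sub (hi1.const_mul _) (hi2.const_mul _), integral_const_mul, integral_const_mul,
    integral_const_mul, integral_norm_sq_eq_one, hI2]
  ring

/-- `𝓔_F(1 + εV, 1 + εV) = ε² 𝓔_F(V, V)` (constants are `𝓔_F`-null; polarisation). [folklore] -/
theorem b2_dirichletFormW_one_add (L : ℝ) {F V : Config N → ℝ} (hF : Continuous F) (ε : ℝ)
    (h1V : IsPeriodicTest L fun X => 1 + ε * V X) :
    dirichletFormW L F (fun X => 1 + ε * V X) (fun X => 1 + ε * V X) =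
      ε ^ 2 * dirichletFormW L F V V := by
  have h := dirichletFormW_sub_sub hF h1V (IsPeriodicTest.const L 1)
  have hsub : ((fun X => 1 + ε * V X) - fun _ : Config N => (1 : ℝ)) = ε • V := by
    funext X; simp
  rw [hsub, dirichletFormW_smul_left, dirichletFormW_smul_right, dirichletFormW_const_right,
    dirichletFormW_const_left, mul_zero, sub_zero, add_zero] at h
  rw [← h]
  ring

/-! ### Expansion of the functionals at the test function `1 + εV` -/

/-- `∫ V(1 + εV)²w = ∫Vw + 2ε∫V²w + ε²∫V³w` and `∫ (1 + εV)²w = ∫w + 2ε∫Vw + ε²∫V²w` for continuous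
`V, w` on the cell. [folklore] -/
theorem b2_integral_expand (L : ℝ) {V w : Config N → ℝ} (hV : Continuous V) (hw : Continuous w)
    (ε : ℝ) :
    (∫ X in cellN N L, V X * (1 + ε * V X) ^ 2 * w X) =
        (∫ X in cellN N L, V X * w X) + 2 * ε * (∫ X in cellN N L, V X ^ 2 * w X) +
          ε ^ 2 * (∫ X in cellN N L, V X ^ 3 * w X) ∧
    (∫ X in cellN N L, (1 + ε * V X) ^ 2 * w X) =
        (∫ X in cellN N L, w X) + 2 * ε * (∫ X in cellN N L, V X * w X) +
          ε ^ 2 * (∫ X in cellN N L, V X ^ 2 * w X) := by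
  have h0 : Integrable w (volume.restrict (cellN N L)) := integrableOn_cellN hw L
  have h1 : Integrable (fun X => V X * w X) (volume.restrict (cellN N L)) :=
    integrableOn_cellN (by fun_prop) L
  have h2 : Integrable (fun X => V X ^ 2 * w X) (volume.restrict (cellN N L)) :=
    integrableOn_cellN (by fun_prop) L
  have h3 : Integrable (fun X => V X ^ 3 * w X) (volume.restrict (cellN N L)) :=
    integrableOn_cellN (by fun_prop) L
  constructor
  · have hpt : (fun X => V X * (1 + ε * V X) ^ 2 * w X) =
        fun X => (V X * w X + 2 * ε * (V X ^ 2 * w X)) + ε ^ 2 * (V X ^ 3 * w X) := by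
      funext X; ring
    have h12 : Integrable (fun X => V X * w X + 2 * ε * (V X ^ 2 * w X))
        (volume.restrict (cellN N L)) := h1.add (h2.const_mul _)
    rw [hpt, integral_add h12 (h3.const_mul _), integral_add h1 (h2.const_mul _),
      integral_const_mul, integral_const_mul]
  · have hpt : (fun X => (1 + ε * V X) ^ 2 * w X) =
        fun X => (w X + 2 * ε * (V X * w X)) + ε ^ 2 * (V X ^ 2 * w X) := by
      funext X; ring
    have h01 : Integrable (fun X => w X + 2 * ε * (V X * w X))
        (volume.restrict (cellN N L)) := h0.add (h1.const_mul _)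
    rw [hpt, integral_add h01 (h2.const_mul _), integral_add h0 (h1.const_mul _),
      integral_const_mul, integral_const_mul]

/-- The limit `ε → 0` in `(2A + εB)² ≤ K(1 + ε²A)E` (`ε ≠ 0`): `4A² ≤ KE`. [folklore] -/
theorem b2_limit {A B K E : ℝ}
    (h : ∀ ε : ℝ, ε ≠ 0 → (2 * A + ε * B) ^ 2 ≤ K * (1 + ε ^ 2 * A) * E) :
    4 * A ^ 2 ≤ K * E := by
  have hlim1 : Tendsto (fun ε : ℝ => (2 * A + ε * B) ^ 2) (𝓝[≠] 0) (𝓝 ((2 * A + 0 * B) ^ 2)) :=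
    tendsto_nhdsWithin_of_tendsto_nhds
      ((Continuous.tendsto (by fun_prop : Continuous fun ε : ℝ => (2 * A + ε * B) ^ 2) 0))
  have hlim2 : Tendsto (fun ε : ℝ => K * (1 + ε ^ 2 * A) * E) (𝓝[≠] 0)
      (𝓝 (K * (1 + 0 ^ 2 * A) * E)) :=
    tendsto_nhdsWithin_of_tendsto_nhds
      ((Continuous.tendsto (by fun_prop : Continuous fun ε : ℝ => K * (1 + ε ^ 2 * A) * E) 0))
  have hle := le_of_tendsto_of_tendsto hlim1 hlim2 (eventually_nhdsWithin_of_forall h)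
  nlinarith [hle]

/-! ### The stub -/

/-- **B2 `stub_responseToHyperuniformity`** (brick B2 of line `stable-fraction-square-completion`,
the converse moment bound `m₀² ≤ m₁ m₋₁` in variational dress).  If the all-states discriminant
`(∫ V_p F²|Θ|²)² ≤ K (∫F²|Θ|²) 𝓔_{|Θ|}(F,F)` holds for every Bose-symmetric periodic `C¹` test `F`,
for a periodic state `Θ` of total momentum `0` and `V_p = ∑ⱼ cos(p·xⱼ)`, `p = 2πk/L`, `k ≠ 0`, then
`(∫ V_p²|Θ|²)² ≤ K·N|p|²/8`.  Proof: test `F = 1 + εV_p`; by translation invariance of `|Θ|²`,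
`∫V_p|Θ|² = 0` and `∫∑ⱼcos(2p·xⱼ)|Θ|² = 0`, whence `𝓔(V_p,V_p) = N|p|²/2`,
`∫V_pF²|Θ|² = 2εA + ε²B`, `∫F²|Θ|² = 1 + ε²A`, `𝓔(F,F) = ε²N|p|²/2`; divide by `ε²` and let
`ε → 0`. [cite: Stringari1995, §3 (40)] -/
theorem stub_responseToHyperuniformity :
    ∀ (N : ℕ) (L : ℝ), 0 < L → ∀ (k : Fin 3 → ℤ), k ≠ 0 → ∀ (Θ : PeriodicTrialState N L),
      HasTotalMomentum 0 Θ.ψ → ∀ K : ℝ, 0 ≤ K →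
        (∀ F : Config N → ℝ, IsPeriodicTest L F →
          (∀ (σ : Equiv.Perm (Fin N)) (X : Config N), F (X ∘ σ) = F X) →
          (∫ X in cellN N L,
              (∑ j, Real.cos (2 * Real.pi / L * ∑ i, (k i : ℝ) * X j i)) * F X ^ 2 * ‖Θ.ψ X‖ ^ 2) ^ 2 ≤
            K * (∫ X in cellN N L, F X ^ 2 * ‖Θ.ψ X‖ ^ 2) *
              dirichletFormW L (fun X => ‖Θ.ψ X‖) F F) →
        (∫ X in cellN N L,
            (∑ j, Real.cos (2 * Real.pi / L * ∑ i, (k i : ℝ) * X j i)) ^ 2 * ‖Θ.ψ X‖ ^ 2) ^ 2 ≤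
          K * (N * psq L k / 8) := by
  intro N L hL k hk Θ hΘ K _hK h
  have hψc := Θ.contDiff.continuous
  have hVc : Continuous fun X : Config N => ∑ j, Real.cos (arg L k (X j)) :=
    (b2_contDiff_sumCos L k).continuous
  have hwc : Continuous fun X : Config N => ‖Θ.ψ X‖ ^ 2 := by fun_prop
  have hwtr : ∀ (s : Space) (X : Config N), ‖Θ.ψ (X + fun _ => s)‖ ^ 2 = ‖Θ.ψ X‖ ^ 2 := by
    intro s X
    rw [show (X + fun _ => s) = fun i => X i + s from rfl, hasTotalMomentum_zero_iff.mp hΘ s X]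
  have hwper : ∀ (X : Config N) (i : Fin N) (a : Fin 3),
      ‖Θ.ψ (X + Pi.single i (EuclideanSpace.single a L))‖ ^ 2 = ‖Θ.ψ X‖ ^ 2 := fun X i a => by
    rw [Θ.periodic]
  have hV := b2_isPeriodicTest_sumCos (N := N) hL.ne' k
  -- the three numbers
  have hI1 : ∫ X in cellN N L, (∑ j, Real.cos (arg L k (X j))) * ‖Θ.ψ X‖ ^ 2 = 0 :=
    b2_integral_sumCos_mul_eq_zero (w := fun X => ‖Θ.ψ X‖ ^ 2) hL hk hwper hwtr
  have hE := b2_dirichletFormW_sumCos hL hk Θ hwtr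
  have hone := integral_norm_sq_eq_one Θ
  -- the discriminant at `F = 1 + εV`
  have hineq : ∀ ε : ℝ, ε ≠ 0 →
      (2 * (∫ X in cellN N L, (∑ j, Real.cos (arg L k (X j))) ^ 2 * ‖Θ.ψ X‖ ^ 2) +
          ε * (∫ X in cellN N L, (∑ j, Real.cos (arg L k (X j))) ^ 3 * ‖Θ.ψ X‖ ^ 2)) ^ 2 ≤
        K * (1 + ε ^ 2 * (∫ X in cellN N L, (∑ j, Real.cos (arg L k (X j))) ^ 2 * ‖Θ.ψ X‖ ^ 2)) *
          (N * psq L k / 2) := by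
    intro ε hε
    have hF : IsPeriodicTest L fun X : Config N => 1 + ε * ∑ j, Real.cos (arg L k (X j)) := by
      refine ⟨by fun_prop, fun X i a => ?_⟩
      dsimp only
      rw [UvThomsonForceWave.sum_cos_add_single hL.ne']
    have hFsymm : ∀ (σ : Equiv.Perm (Fin N)) (X : Config N),
        (1 + ε * ∑ j, Real.cos (arg L k ((X ∘ σ) j))) = 1 + ε * ∑ j, Real.cos (arg L k (X j)) :=
      fun σ X => by rw [b2_sumCos_perm]
    have h1 : (∫ X in cellN N L, (∑ j, Real.cos (arg L k (X j))) *
        (1 + ε * ∑ j, Real.cos (arg L k (X j))) ^ 2 * ‖Θ.ψ X‖ ^ 2) ^ 2 ≤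
        K * (∫ X in cellN N L, (1 + ε * ∑ j, Real.cos (arg L k (X j))) ^ 2 * ‖Θ.ψ X‖ ^ 2) *
          dirichletFormW L (fun X => ‖Θ.ψ X‖) (fun X => 1 + ε * ∑ j, Real.cos (arg L k (X j)))
            (fun X => 1 + ε * ∑ j, Real.cos (arg L k (X j))) := h _ hF hFsymm
    obtain ⟨hx1, hx2⟩ := b2_integral_expand L hVc hwc ε
    rw [hx1, hx2, b2_dirichletFormW_one_add L (by fun_prop) ε hF, hE, hI1, hone] at h1
    have hε2 : 0 < ε ^ 2 := by positivity
    refine le_of_mul_le_mul_left ?_ hε2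
    nlinarith [h1]
  have hfin := b2_limit hineq
  have key : (∫ X in cellN N L, (∑ j, Real.cos (arg L k (X j))) ^ 2 * ‖Θ.ψ X‖ ^ 2) ^ 2 ≤
      K * (N * psq L k / 8) := by nlinarith [hfin]
  exact key

end

end Summit.AtomisticToContinuum.BoseEinsteinCondensation.Cruxes.StaticResponseBound.StableFractionSquareCompletion
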